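import Summits.QuantumFields.BalabanUV.T4Continuum.Support.AveragingDeficitPlaqList

/-!
# AveragingDeficitFluxExpansion (T⁴ programme, node NE3, row NE3-R2, gen 4) — THE POINTWISE SECOND-ORDER EXPANSION OF
# THE COVARIANT FLUX GRADIENT IN A LOCAL EXPONENTIAL GAUGE: for `U(N)`-valued `V` with `V(b) = exp a(b)` on the bonds
# near `x`, `‖a‖ ≤ α₀`, first differences `‖∇a‖ ≤ α₁` (`α₀, α₁ ≤ 1/8`),
# `‖(∇_V F)(x, κ; μν)‖ ≤ ‖D_μD_κ a_ν(x) − D_νD_κ a_μ(x)‖ + k(α₀, α₁)`, `k ≤ 90α₀α₁ + 32α₁² + 360α₀³`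

HONEST FRAMING (cell `pub-balaban`, T4-DAG PAGE 1; unit `b2b-balaban-t4-ne3r2-p1` = owner of BINDER-OWNERS row NE3-R2,
gen 4).  The cell's T4 target is the finite-torus continuum limit of the unit-scale averaged loop expectations — NOT
infinite volume, NO mass gap, NOT Clay, NOT summit progress.  THE K-DATUM PROGRAMME (this gen): both the NE3 energy
route (this row's `AveragingDeficitDualResidual.dualResidual_torus`, factor `√gradFluxSq`) and row NE3's action sandwich
(`MinimalActionRate.Regular.grad`, hypothesis (H3) of `SandwichData`) consume the `ℓ²` norm of the COVARIANT GRADIENT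
OF THE FLUX `‖∇_U F‖_{ℓ²}` (`T4AveragingDeficitWall.gradFluxSq`), while B11 Theorem 1 prints, per cube and in a local
gauge `U = e^{iηA}`, SUP bounds on `A`, `∇^ηA` ((8)) and `∂^{η*}∂^ηA`, `Δ^ηA` ((10)).  This file is the POINTWISE half of the
conversion: in an exponential gauge the covariant flux gradient is the mixed second difference of the potential (the
abelian linear term) up to a remainder made of PRODUCTS of sup quantities, third order in the scaling `α₀ ~ L^{−j}`,
`α₁ ~ L^{−2j}` of (8).  The mixed second differences are then controlled in `ℓ²`, cube by cube, by the flat Laplacian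
through the discrete Caccioppoli inequality `AveragingDeficitLatticeH2.latticeH2`; the assembly is `AveragingDeficitKDatum`.

CONTENT (all [folklore], 0 sorry; the plaquette-list algebra is `AveragingDeficitPlaqList`; NO definitions here — the radius
`w(α₀,α₁) = 2α₁ + ρ(4α₀)` and the remainder `k(α₀,α₁) = 16α₀α₁ + 2T₃(4α₀) + 2ρ(2w) + 4(e^{α₀}−1)w` are written out, and get the names
`wRad`, `kRem` in `AveragingDeficitKDatum`): `wRad_le_half` (`w ≤ 1/2` for `α₀, α₁ ≤ 1/8`), `wRad_nonneg`, `norm_holonomy_plaqList`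
(second-order Taylor remainder `≤ T₃(4α₀)` and `‖V(∂p) − 1‖ ≤ w`), **`norm_covGrad_flux_le`** (the displayed bound: unitary dressing
`AveragingDeficitNearIdentity.norm_Ad_sub_le`, first-order logarithm `B7Prop1Explicit.norm_mlog_sub_le`, two Taylor
remainders `Beta.TransportVertices.norm_holonomy_sub_taylor_two_le`, the `quad` difference `16α₀α₁`
(`AveragingDeficitPlaqList.Close.norm_quad_sub_le`), and the EXACT second-difference term
`AveragingDeficitPlaqList.sum_plaqList_sub`), `kRem_le` (`k ≤ 90α₀α₁ + 32α₁² + 360α₀³`, via `Real.exp_bound'`), `kRem_nonneg`,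
`norm_fhol_sub_one_le` (the plaquettes at `x` and `x + e_κ` are within `w ≤ 1/2` of `1`).
What is NOT here: the `ℓ²` summation and the gauge covariance (file `AveragingDeficitKDatum`), anything about minimisers.
Context: T. Bałaban, Commun. Math. Phys. **102** (1985) 277–309 [Balaban1985Variational], Thm 1 (8)–(10) p. 279;
**99** (1985) 389–434 [Balaban1985BackgroundPropagators] (3.2)–(3.6) pp. 390–391 (the second-order plaquette expansion,
kernel form `Beta.TransportVertices`); **98** (1985) 17–51 [Balaban1985Averaging] (21) p. 21 (the flux as a logarithm).
No printed sentence is a hypothesis.  PLACEMENT: `Summits/QuantumFields/BalabanUV/` (human rule 2026-08-19).  Record: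
HOME `t4/T4-EST-NE3-R2.md` v0.5.
-/

set_option autoImplicit false

open scoped BigOperators Matrix.Norms.L2Operator
open NormedSpace

namespace Summit.QuantumFields.BalabanUV.T4Continuum.AveragingDeficitFluxExpansion

open Literature.MathematicalPhysics.QuantumFieldTheory.Balaban1983to89
open B7Prop1Explicit B7Prop2Explicit MatrixLog UnitaryModel
open T4AveragingDeficitWall hiding Site Plane Plaq Bond
open Beta.TransportVertices (holonomy quad size expTail norm_holonomy_sub_taylor_two_le expTail_mono expTail_nonneg
  size_nonneg norm_quad_le norm_sum_le_size expTail_three)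
open AveragingDeficitTransport (norm_Ad_of_unitary mem_U1_of_unitary)
open AveragingDeficitNearIdentity (norm_Ad_sub_le)
open AveragingDeficitLatticeH2Prep (fd)
open AveragingDeficitPlaqList

noncomputable section

variable {d : ℕ} {n : Type*} [Fintype n] [DecidableEq n]

/-! ## §4 THE POINTWISE EXPANSION OF THE COVARIANT FLUX GRADIENT IN AN EXPONENTIAL GAUGE -/

/-- The radius `w(α₀,α₁) = 2α₁ + ρ(4α₀)` (`ρ(t) = e^t − 1 − t`; the size of `V(∂p) − 1` in the exponential gauge) is
`≤ 1/2` in the regime `α₀, α₁ ≤ 1/8`. [folklore] -/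
theorem wRad_le_half {α₀ α₁ : ℝ} (hα₀ : 0 ≤ α₀) (hα₀' : α₀ ≤ 1 / 8) (hα₁' : α₁ ≤ 1 / 8) :
    2 * α₁ + expRem (4 * α₀) ≤ 1 / 2 := by
  have h1 : expRem (4 * α₀) ≤ (4 * α₀) ^ 2 := expRem_le_sq (by positivity) (by linarith)
  nlinarith

/-- `0 ≤ w(α₀,α₁)`. [folklore] -/
theorem wRad_nonneg {α₀ α₁ : ℝ} (hα₁ : 0 ≤ α₁) : 0 ≤ 2 * α₁ + expRem (4 * α₀) :=
  add_nonneg (by positivity) (expRem_nonneg _)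

/-- In the exponential gauge: `‖V(∂p) − 1‖ ≤ w` and the second-order Taylor remainder of `V(∂p)` is `≤ T₃(4α₀)`.
[folklore] -/
theorem norm_holonomy_plaqList {a : Site d → Fin d → Matrix n n ℂ} {x : Site d} {μ ν : Fin d} {α₀ α₁ : ℝ}
    (hs : size (plaqList a x μ ν) ≤ 4 * α₀) (hc : ‖(plaqList a x μ ν).sum‖ ≤ 2 * α₁) :
    ‖holonomy (plaqList a x μ ν) - 1 - (plaqList a x μ ν).sum - quad ℂ (plaqList a x μ ν)‖ ≤ expTail 3 (4 * α₀)
      ∧ ‖holonomy (plaqList a x μ ν) - 1‖ ≤ 2 * α₁ + expRem (4 * α₀) := by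
  set l := plaqList a x μ ν
  have h0 := size_nonneg l
  have hT : ‖holonomy l - 1 - l.sum - quad ℂ l‖ ≤ expTail 3 (4 * α₀) :=
    (norm_holonomy_sub_taylor_two_le ℂ l).trans (expTail_mono 3 h0 hs)
  refine ⟨hT, ?_⟩
  have hq : ‖quad ℂ l‖ ≤ (4 * α₀) ^ 2 / 2 :=
    (norm_quad_le ℂ l).trans (by gcongr)
  have e1 : holonomy l - 1 = (holonomy l - 1 - l.sum - quad ℂ l) + l.sum + quad ℂ l := by abel
  rw [e1]
  calc ‖holonomy l - 1 - l.sum - quad ℂ l + l.sum + quad ℂ l‖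
      ≤ expTail 3 (4 * α₀) + 2 * α₁ + (4 * α₀) ^ 2 / 2 := (norm_add₃_le).trans (add_le_add_three hT hc hq)
    _ = 2 * α₁ + expRem (4 * α₀) := by rw [expRem, expTail_three]; ring

/-- **THE POINTWISE K-DATUM EXPANSION.**  Let `V` be `U(N)`-valued and, on the bonds within `ℓ¹`-distance `2` of `x`,
of the form `V(b) = exp a(b)` with `‖a(b)‖ ≤ α₀`, and let the first differences of `a` within distance `1` of `x`
be `≤ α₁` (`α₀, α₁ ≤ 1/8`).  Then for every direction `κ` and plane `μ < ν`
`‖(∇_V F)(x, κ; μν)‖ ≤ ‖D_μD_κ a_ν(x) − D_νD_κ a_μ(x)‖ + k(α₀, α₁)`,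
`k = 16α₀α₁ + 2T₃(4α₀) + 2ρ(2w) + 4(e^{α₀}−1)w` (named `kRem` in `AveragingDeficitKDatum`):
the covariant gradient of the flux is the mixed second difference of the potential (the abelian, linear term — the
one the discrete Caccioppoli inequality controls in `ℓ²`) plus a remainder made of products of sup quantities
(`quad` is Lipschitz: `16α₀α₁`; third-order Taylor: `2T₃(4α₀)`; first-order logarithm: `2ρ(2w)`; unitary dressing:
`4(e^{α₀}−1)w`). [folklore] -/
theorem norm_covGrad_flux_le [Nonempty n] {V : Site d → Fin d → (Matrix n n ℂ)ˣ} (hV : IsUnitaryCfg V)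
    {a : Site d → Fin d → Matrix n n ℂ} {x : Site d} {α₀ α₁ : ℝ} (hα₀ : 0 ≤ α₀) (hα₁ : 0 ≤ α₁) (hα₀' : α₀ ≤ 1 / 8)
    (hα₁' : α₁ ≤ 1 / 8) (hexp : ∀ y τ, l1 (y - x) ≤ 2 → ((V y τ : (Matrix n n ℂ)ˣ) : Matrix n n ℂ) = exp (a y τ))
    (h0 : ∀ y τ, l1 (y - x) ≤ 2 → ‖a y τ‖ ≤ α₀)
    (h1 : ∀ y τ i, l1 (y - x) ≤ 1 → ‖fd i (fun z => a z τ) y‖ ≤ α₁)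
    (κ μ ν : Fin d) (hlt : μ < ν) :
    ‖covGrad V (flux V) x κ ⟨(μ, ν), hlt⟩‖
      ≤ ‖fd μ (fd κ (fun z => a z ν)) x - fd ν (fd κ (fun z => a z μ)) x‖
        + (16 * α₀ * α₁ + 2 * expTail 3 (4 * α₀) + 2 * expRem (2 * (2 * α₁ + expRem (4 * α₀)))
          + 4 * (Real.exp α₀ - 1) * (2 * α₁ + expRem (4 * α₀))) := by
  -- geometry of the nine bonds
  have dx : l1 (x - x) ≤ 2 := by simp [l1]
  have dx1 : l1 (x - x) ≤ 1 := by simp [l1]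
  have dμ : l1 (x + e μ - x) ≤ 2 := by rw [add_sub_cancel_left, l1_e]; omega
  have dν : l1 (x + e ν - x) ≤ 2 := by rw [add_sub_cancel_left, l1_e]; omega
  have dκ : l1 (x + e κ - x) ≤ 2 := by rw [add_sub_cancel_left, l1_e]; omega
  have dκ1 : l1 (x + e κ - x) ≤ 1 := by rw [add_sub_cancel_left, l1_e]
  have dκμ : l1 (x + e κ + e μ - x) ≤ 2 := by
    rw [show x + e κ + e μ - x = e κ + e μ by abel]; exact (l1_add_le _ _).trans (by rw [l1_e, l1_e])
  have dκν : l1 (x + e κ + e ν - x) ≤ 2 := by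
    rw [show x + e κ + e ν - x = e κ + e ν by abel]; exact (l1_add_le _ _).trans (by rw [l1_e, l1_e])
  -- the two holonomies
  set l := plaqList a x μ ν with hl
  set l' := plaqList a (x + e κ) μ ν with hl'
  have hW : ((fhol V (x, ⟨(μ, ν), hlt⟩) : (Matrix n n ℂ)ˣ) : Matrix n n ℂ) = holonomy l :=
    fhol_eq_holonomy (hexp _ _ dx) (hexp _ _ dμ) (hexp _ _ dν) (hexp _ _ dx) hlt
  have hW' : ((fhol V (x + e κ, ⟨(μ, ν), hlt⟩) : (Matrix n n ℂ)ˣ) : Matrix n n ℂ) = holonomy l' :=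
    fhol_eq_holonomy (hexp _ _ dκ) (hexp _ _ dκμ) (hexp _ _ dκν) (hexp _ _ dκ) hlt
  -- sizes
  have hs : size l ≤ 4 * α₀ := size_plaqList_le (h0 _ _ dx) (h0 _ _ dμ) (h0 _ _ dν) (h0 _ _ dx)
  have hs' : size l' ≤ 4 * α₀ := size_plaqList_le (h0 _ _ dκ) (h0 _ _ dκμ) (h0 _ _ dκν) (h0 _ _ dκ)
  have hc : ‖l.sum‖ ≤ 2 * α₁ := norm_sum_plaqList_le (h1 _ _ _ dx1) (h1 _ _ _ dx1)
  have hc' : ‖l'.sum‖ ≤ 2 * α₁ := norm_sum_plaqList_le (h1 _ _ _ dκ1) (h1 _ _ _ dκ1)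
  have hq : ‖quad ℂ l' - quad ℂ l‖ ≤ 16 * α₀ * α₁ := by
    have h := (close_plaqList (κ := κ) (μ := μ) (ν := ν) h0 fun y τ hy => h1 y τ κ hy).norm_quad_sub_le hα₀ hα₁
    have hlen : (plaqList a x μ ν).length = 4 := rfl
    rw [hlen] at h
    norm_num at h
    linarith
  -- Taylor and the size of `W − 1`
  obtain ⟨hT, hW1⟩ := norm_holonomy_plaqList (α₁ := α₁) hs hc
  obtain ⟨hT', hW1'⟩ := norm_holonomy_plaqList (α₁ := α₁) hs' hc'
  have hw := wRad_le_half hα₀ hα₀' hα₁'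
  have hw0 := wRad_nonneg (α₀ := α₀) hα₁
  set w := 2 * α₁ + expRem (4 * α₀) with hwdef
  -- logarithms
  have hL : ‖mlog (holonomy l) - (holonomy l - 1)‖ ≤ expRem (2 * w) :=
    (norm_mlog_sub_le (hW1.trans hw)).trans (expRem_mono (by positivity) (by linarith))
  have hL' : ‖mlog (holonomy l') - (holonomy l' - 1)‖ ≤ expRem (2 * w) :=
    (norm_mlog_sub_le (hW1'.trans hw)).trans (expRem_mono (by positivity) (by linarith))
  have hlog' : ‖mlog (holonomy l')‖ ≤ 2 * w :=
    (norm_mlog_le_two_mul (hW1'.trans hw)).trans (by linarith)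
  -- the unitary dressing
  have hU : ‖((V x κ : (Matrix n n ℂ)ˣ) : Matrix n n ℂ) - 1‖ ≤ Real.exp α₀ - 1 := by
    rw [hexp x κ dx]; exact (norm_exp_sub_one_le_of_norm_le (h0 x κ dx)).1
  have hAd : ‖Ad (V x κ) (mlog (holonomy l')) - mlog (holonomy l')‖
      ≤ 2 * (Real.exp α₀ - 1) * (2 * w) :=
    (norm_Ad_sub_le (hV x κ) _).trans (mul_le_mul (mul_le_mul_of_nonneg_left hU (by norm_num)) hlog'
      (norm_nonneg _) (by have := Real.add_one_le_exp α₀; nlinarith))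
  -- assemble
  have hcov : covGrad V (flux V) x κ ⟨(μ, ν), hlt⟩ = Ad (V x κ) (mlog (holonomy l')) - mlog (holonomy l) := by
    simp only [covGrad, flux, hW, hW']
  have e1 : Ad (V x κ) (mlog (holonomy l')) - mlog (holonomy l)
      = (Ad (V x κ) (mlog (holonomy l')) - mlog (holonomy l'))
        + (mlog (holonomy l') - (holonomy l' - 1)) - (mlog (holonomy l) - (holonomy l - 1))
        + ((holonomy l' - 1 - l'.sum - quad ℂ l') - (holonomy l - 1 - l.sum - quad ℂ l))
        + (quad ℂ l' - quad ℂ l) + (l'.sum - l.sum) := by abel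
  rw [hcov, e1, ← sum_plaqList_sub a x κ μ ν]
  calc _ ≤ ‖Ad (V x κ) (mlog (holonomy l')) - mlog (holonomy l')‖
        + ‖mlog (holonomy l') - (holonomy l' - 1)‖ + ‖mlog (holonomy l) - (holonomy l - 1)‖
        + (‖holonomy l' - 1 - l'.sum - quad ℂ l'‖ + ‖holonomy l - 1 - l.sum - quad ℂ l‖)
        + ‖quad ℂ l' - quad ℂ l‖ + ‖l'.sum - l.sum‖ := by
          refine (norm_add_le _ _).trans (add_le_add ((norm_add_le _ _).trans (add_le_add
            ((norm_add_le _ _).trans (add_le_add ((norm_sub_le _ _).trans (add_le_add (norm_add_le _ _) le_rfl))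
            (norm_sub_le _ _))) le_rfl)) le_rfl)
    _ ≤ 2 * (Real.exp α₀ - 1) * (2 * w) + expRem (2 * w) + expRem (2 * w)
        + (expTail 3 (4 * α₀) + expTail 3 (4 * α₀)) + 16 * α₀ * α₁ + ‖l'.sum - l.sum‖ := by
          gcongr
    _ = _ := by ring

/-- A crude polynomial bound on the remainder in the regime `α₀, α₁ ≤ 1/8`:
`k(α₀,α₁) ≤ 90α₀α₁ + 32α₁² + 360α₀³` (third order in the scaling `α₀ ~ L^{−j}`, `α₁ ~ L^{−2j}`). [folklore] -/
theorem kRem_le {α₀ α₁ : ℝ} (hα₀ : 0 ≤ α₀) (hα₁ : 0 ≤ α₁) (hα₀' : α₀ ≤ 1 / 8) (hα₁' : α₁ ≤ 1 / 8) :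
    16 * α₀ * α₁ + 2 * expTail 3 (4 * α₀) + 2 * expRem (2 * (2 * α₁ + expRem (4 * α₀)))
        + 4 * (Real.exp α₀ - 1) * (2 * α₁ + expRem (4 * α₀))
      ≤ 90 * α₀ * α₁ + 32 * α₁ ^ 2 + 360 * α₀ ^ 3 := by
  have hw := wRad_le_half hα₀ hα₀' hα₁'
  have hw0 := wRad_nonneg (α₀ := α₀) hα₁
  set w := 2 * α₁ + expRem (4 * α₀) with hwdef
  set w' := 2 * α₁ + 16 * α₀ ^ 2 with hw'def
  have hwle : w ≤ w' := by
    rw [hwdef]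
    have h1 : expRem (4 * α₀) ≤ (4 * α₀) ^ 2 := expRem_le_sq (by positivity) (by linarith)
    nlinarith
  -- third-order Taylor tail: `T₃(t) ≤ (2/9) t³` on `[0,1]`
  have hT3 : expTail 3 (4 * α₀) ≤ 2 / 9 * (4 * α₀) ^ 3 := by
    have h := Real.exp_bound' (x := 4 * α₀) (by positivity) (by linarith) (n := 3) (by norm_num)
    rw [expTail_three]
    simp only [Finset.sum_range_succ, Finset.sum_range_zero, Nat.factorial, Nat.cast_ofNat, pow_zero,
      pow_one] at h
    norm_num at h
    linarith [h]
  have hT3' : 2 * expTail 3 (4 * α₀) ≤ 29 * α₀ ^ 3 := by nlinarith [pow_nonneg hα₀ 3]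
  -- first-order log remainder
  have hR : expRem (2 * w) ≤ (2 * w) ^ 2 := expRem_le_sq (by positivity) (by linarith)
  have hw'sq : w' ^ 2 ≤ 4 * α₁ ^ 2 + 8 * α₀ * α₁ + 32 * α₀ ^ 3 := by
    have e : w' ^ 2 = 4 * α₁ ^ 2 + 64 * (α₀ * (α₀ * α₁)) + 256 * (α₀ * α₀ ^ 3) := by rw [hw'def]; ring
    rw [e]
    have h1 : α₀ * (α₀ * α₁) ≤ 1 / 8 * (α₀ * α₁) := mul_le_mul_of_nonneg_right hα₀' (mul_nonneg hα₀ hα₁)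
    have h2 : α₀ * α₀ ^ 3 ≤ 1 / 8 * α₀ ^ 3 := mul_le_mul_of_nonneg_right hα₀' (pow_nonneg hα₀ 3)
    linarith
  have hR' : 2 * expRem (2 * w) ≤ 32 * α₁ ^ 2 + 64 * α₀ * α₁ + 256 * α₀ ^ 3 := by
    have h1 : (2 * w) ^ 2 ≤ 4 * w' ^ 2 := by nlinarith
    linarith
  -- the dressing term
  have hE : Real.exp α₀ - 1 ≤ 9 / 8 * α₀ := by
    have h := expRem_le_sq hα₀ (by linarith); unfold expRem at h; nlinarith
  have hE0 : 0 ≤ Real.exp α₀ - 1 := by have := Real.add_one_le_exp α₀; linarith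
  have hD : 4 * (Real.exp α₀ - 1) * w ≤ 9 * α₀ * α₁ + 72 * α₀ ^ 3 := by
    have h1 : (Real.exp α₀ - 1) * w ≤ (9 / 8 * α₀) * w' := mul_le_mul hE hwle hw0 (by positivity)
    have e : 4 * ((9 / 8 * α₀) * w') = 9 * α₀ * α₁ + 72 * α₀ ^ 3 := by rw [hw'def]; ring
    linarith
  have hp1 : 0 ≤ α₀ * α₁ := mul_nonneg hα₀ hα₁
  have hp3 : 0 ≤ α₀ ^ 3 := pow_nonneg hα₀ 3
  nlinarith


/-- `0 ≤ k(α₀,α₁)`. [folklore] -/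
theorem kRem_nonneg {α₀ α₁ : ℝ} (hα₀ : 0 ≤ α₀) (hα₁ : 0 ≤ α₁) :
    0 ≤ 16 * α₀ * α₁ + 2 * expTail 3 (4 * α₀) + 2 * expRem (2 * (2 * α₁ + expRem (4 * α₀)))
        + 4 * (Real.exp α₀ - 1) * (2 * α₁ + expRem (4 * α₀)) := by
  have hw0 := wRad_nonneg (α₀ := α₀) hα₁
  have hE0 : 0 ≤ Real.exp α₀ - 1 := by have := Real.add_one_le_exp α₀; linarith
  have := expTail_nonneg 3 (by positivity : 0 ≤ 4 * α₀)
  have := expRem_nonneg (2 * (2 * α₁ + expRem (4 * α₀)))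
  positivity

/-- In the exponential gauge the plaquette variables at `x` and at every `x + e_κ` are within `w ≤ 1/2` of the
identity (so the logarithm and the gauge-covariance lemmas apply). [folklore] -/
theorem norm_fhol_sub_one_le {V : Site d → Fin d → (Matrix n n ℂ)ˣ} {a : Site d → Fin d → Matrix n n ℂ} {x : Site d} {α₀ α₁ : ℝ}
    (hexp : ∀ y τ, l1 (y - x) ≤ 2 → ((V y τ : (Matrix n n ℂ)ˣ) : Matrix n n ℂ) = exp (a y τ))
    (h0 : ∀ y τ, l1 (y - x) ≤ 2 → ‖a y τ‖ ≤ α₀)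
    (h1 : ∀ y τ i, l1 (y - x) ≤ 1 → ‖fd i (fun z => a z τ) y‖ ≤ α₁) (κ μ ν : Fin d) (hlt : μ < ν) :
    ‖((fhol V (x, ⟨(μ, ν), hlt⟩) : (Matrix n n ℂ)ˣ) : Matrix n n ℂ) - 1‖ ≤ 2 * α₁ + expRem (4 * α₀)
      ∧ ‖((fhol V (x + e κ, ⟨(μ, ν), hlt⟩) : (Matrix n n ℂ)ˣ) : Matrix n n ℂ) - 1‖ ≤ 2 * α₁ + expRem (4 * α₀) := by
  have dx : l1 (x - x) ≤ 2 := by simp [l1]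
  have dx1 : l1 (x - x) ≤ 1 := by simp [l1]
  have dμ : l1 (x + e μ - x) ≤ 2 := by rw [add_sub_cancel_left, l1_e]; omega
  have dν : l1 (x + e ν - x) ≤ 2 := by rw [add_sub_cancel_left, l1_e]; omega
  have dκ : l1 (x + e κ - x) ≤ 2 := by rw [add_sub_cancel_left, l1_e]; omega
  have dκ1 : l1 (x + e κ - x) ≤ 1 := by rw [add_sub_cancel_left, l1_e]
  have dκμ : l1 (x + e κ + e μ - x) ≤ 2 := by
    rw [show x + e κ + e μ - x = e κ + e μ by abel]; exact (l1_add_le _ _).trans (by rw [l1_e, l1_e])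
  have dκν : l1 (x + e κ + e ν - x) ≤ 2 := by
    rw [show x + e κ + e ν - x = e κ + e ν by abel]; exact (l1_add_le _ _).trans (by rw [l1_e, l1_e])
  constructor
  · rw [fhol_eq_holonomy (hexp _ _ dx) (hexp _ _ dμ) (hexp _ _ dν) (hexp _ _ dx) hlt]
    exact (norm_holonomy_plaqList (size_plaqList_le (h0 _ _ dx) (h0 _ _ dμ) (h0 _ _ dν) (h0 _ _ dx))
      (norm_sum_plaqList_le (h1 _ _ _ dx1) (h1 _ _ _ dx1))).2
  · rw [fhol_eq_holonomy (hexp _ _ dκ) (hexp _ _ dκμ) (hexp _ _ dκν) (hexp _ _ dκ) hlt]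
    exact (norm_holonomy_plaqList (size_plaqList_le (h0 _ _ dκ) (h0 _ _ dκμ) (h0 _ _ dκν) (h0 _ _ dκ))
      (norm_sum_plaqList_le (h1 _ _ _ dκ1) (h1 _ _ _ dκ1))).2

end

end Summit.QuantumFields.BalabanUV.T4Continuum.AveragingDeficitFluxExpansion
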